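import Summits.RiemannHypothesis.RiemannHypothesis.Theorems.EtaLeadingQuarterSecondMomentAFESpecial
import Summits.RiemannHypothesis.RiemannHypothesis.Theorems.EtaLeadingQuarterSecondMomentAlt
import HarnessLib

/-!
# Sharp-ended eta vector at the zeros, VII: the engine interface
# (route EtaLeadingQuarter, item `EtaLeadingSecondMoment`, stmt-RiemannHypothesis-21791)

The pointwise input of the second moment over the zeros, in the shape agreed on the cell bus
(rh-split STATUS 2026-08-27T22:38Z/23:0xZ): for `M = 2L`, a zero `s = 1/2 + it` of `ζ` (`t ≥ 1`),
`T_M(s) = ∑_{m ≤ M} (−1)^m m^{-s}`, `S = ∑_{ν ≤ [t/(2πL)], ν odd} ν^{s-1}` and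
`d = dist(t/(2πL), ℤ)` (both transition families `t/(2πM) ∈ ℤ` and `∈ ℤ + 1/2`):

* `norm_altSum_add_dual_le_off` — OFF the transition zones (`δ ≤ {t/(2πL)} ≤ 1 − δ`, `L ≥ 1`):
  `‖T_M(s) + afeCoeff(s) 2^{1-s} S‖ ≤ 27 M^{-1/2} (1 + log(t/(2πL) + 2)) + 8 M^{-1/2}/δ`;
* `norm_altSum_add_dual_le_in` — everywhere (`L ≥ 4`):
  `‖T_M(s) + afeCoeff(s) 2^{1-s} S‖ ≤ 27 M^{-1/2} (1 + log(t/(2πL) + 2)) + 14√2/√(t/(2πL))`.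

(`|afeCoeff(s) 2^{1-s}| ≤ √2`; the dual terms have moduli `√(2/ν)`.) From parts V (`_dist`,
`_transition`) and VI (`altSum_identity`). RH-free given the shape `s = 1/2 + it` of the zero.
Nothing here bears on the truth of RH.
-/

noncomputable section

open Complex MeasureTheory Set Filter intervalIntegral Finset
open scoped Real Topology Interval

set_option linter.dupNamespace false  -- the mandated namespace repeats `RiemannHypothesis`

namespace Summit.RiemannHypothesis.RiemannHypothesis.Theorems.EtaLeadingQuarter.SecondMomentAFE

open Literature.NumberTheory.LFunctions Literature.NumberTheory.LFunctions.AFE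

/-- **Duality at a zero, with the dual main term on the left**: if `ζ(s) = 0`, `s = 1/2 + it`,
then `‖T_{2L}(s) + afeCoeff(s) 2^{1-s} S‖ ≤ √2‖Q(L)‖ + ‖Q(2L)‖`. [folklore] -/
theorem norm_altSum_add_dual_le_of_zero (L : ℕ) {t : ℝ} (s : ℂ) (hs : s = 1 / 2 + t * I)
    (hzero : riemannZeta s = 0) :
    ‖∑ m ∈ Finset.Icc 1 (2 * L), (-1 : ℂ) ^ m * (m : ℂ) ^ (-s)
        + afeCoeff s * (2 : ℂ) ^ (1 - s)
          * ∑ ν ∈ (Finset.Icc 1 ⌊t / (2 * π * L)⌋₊).filter (fun ν => Odd ν), (ν : ℂ) ^ (s - 1)‖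
      ≤ Real.sqrt 2 * ‖riemannZeta s - ∑ n ∈ Finset.Icc 1 L, (n : ℂ) ^ (-s)
            + (L : ℂ) ^ (1 - s) / (1 - s)
            - afeCoeff s * ∑ n ∈ Finset.Icc 1 ⌊t / (2 * π * L)⌋₊, (n : ℂ) ^ (s - 1)‖
        + ‖riemannZeta s - ∑ n ∈ Finset.Icc 1 (2 * L), (n : ℂ) ^ (-s)
            + ((2 * L : ℕ) : ℂ) ^ (1 - s) / (1 - s)
            - afeCoeff s * ∑ n ∈ Finset.Icc 1 ⌊t / (2 * π * ((2 * L : ℕ) : ℝ))⌋₊,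
                (n : ℂ) ^ (s - 1)‖ := by
  rw [altSum_identity L s t]
  set SO : ℂ := ∑ ν ∈ (Finset.Icc 1 ⌊t / (2 * π * L)⌋₊).filter (fun ν => Odd ν),
    (ν : ℂ) ^ (s - 1) with hSO
  set Q1 : ℂ := riemannZeta s - ∑ n ∈ Finset.Icc 1 L, (n : ℂ) ^ (-s)
    + (L : ℂ) ^ (1 - s) / (1 - s)
    - afeCoeff s * ∑ n ∈ Finset.Icc 1 ⌊t / (2 * π * L)⌋₊, (n : ℂ) ^ (s - 1) with hQ1
  set Q2 : ℂ := riemannZeta s - ∑ n ∈ Finset.Icc 1 (2 * L), (n : ℂ) ^ (-s)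
    + ((2 * L : ℕ) : ℂ) ^ (1 - s) / (1 - s)
    - afeCoeff s * ∑ n ∈ Finset.Icc 1 ⌊t / (2 * π * ((2 * L : ℕ) : ℝ))⌋₊, (n : ℂ) ^ (s - 1)
    with hQ2
  have h2 : ‖(2 : ℂ) ^ (1 - s)‖ = Real.sqrt 2 := norm_two_cpow_one_sub s hs
  rw [hzero, mul_zero, zero_sub]
  rw [show -(afeCoeff s * (2 : ℂ) ^ (1 - s) * SO) - (2 : ℂ) ^ (1 - s) * Q1 + Q2
      + afeCoeff s * (2 : ℂ) ^ (1 - s) * SO = -((2 : ℂ) ^ (1 - s) * Q1) + Q2 by ring]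
  calc ‖-((2 : ℂ) ^ (1 - s) * Q1) + Q2‖ ≤ ‖-((2 : ℂ) ^ (1 - s) * Q1)‖ + ‖Q2‖ := norm_add_le _ _
    _ = Real.sqrt 2 * ‖Q1‖ + ‖Q2‖ := by rw [norm_neg, norm_mul, h2]

/-- `L^{-1/2} = √2 (2L)^{-1/2}` and `(2L)^{-1/2} ≤ L^{-1/2}`-type bookkeeping: for `L > 0`,
`(L : ℝ)^{-1/2} = √2 · ((2L : ℕ) : ℝ)^{-1/2}`. [folklore] -/
theorem rpow_neg_half_eq_sqrt_two_mul {L : ℕ} (hL : 0 < L) :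
    (L : ℝ) ^ (-(1 / 2 : ℝ)) = Real.sqrt 2 * ((2 * L : ℕ) : ℝ) ^ (-(1 / 2 : ℝ)) := by
  have hL0 : (0 : ℝ) < L := by exact_mod_cast hL
  push_cast
  rw [Real.mul_rpow (by norm_num) hL0.le, ← mul_assoc, Real.sqrt_eq_rpow,
    ← Real.rpow_add two_pos]
  norm_num

/-- Doubling and fractional parts: if `δ ≤ {2u}` and `δ ≤ 1 − {2u}` then `δ/2 ≤ {u}` and
`δ/2 ≤ 1 − {u}`. [folklore] -/
theorem fract_half_bounds {u δ : ℝ} (hδ1 : δ ≤ Int.fract (2 * u)) (hδ2 : δ ≤ 1 - Int.fract (2 * u)) :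
    δ / 2 ≤ Int.fract u ∧ δ / 2 ≤ 1 - Int.fract u := by
  have hf0 : 0 ≤ Int.fract u := Int.fract_nonneg u
  have hf1 : Int.fract u < 1 := Int.fract_lt_one u
  have hF1 : Int.fract (2 * u) < 1 := Int.fract_lt_one _
  have hu : u = ⌊u⌋ + Int.fract u := (Int.floor_add_fract u).symm
  rcases lt_or_ge (Int.fract u) (1 / 2) with hlt | hge
  · -- `{2u} = 2{u}`
    have h2 : Int.fract (2 * u) = 2 * Int.fract u := by
      rw [Int.fract_eq_iff]
      refine ⟨by linarith, by linarith, ⟨2 * ⌊u⌋, ?_⟩⟩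
      push_cast
      nth_rewrite 1 [hu]
      ring
    rw [h2] at hδ1 hδ2
    constructor <;> linarith
  · -- `{2u} = 2{u} - 1`
    have h2 : Int.fract (2 * u) = 2 * Int.fract u - 1 := by
      rw [Int.fract_eq_iff]
      refine ⟨by linarith, by linarith, ⟨2 * ⌊u⌋ + 1, ?_⟩⟩
      push_cast
      nth_rewrite 1 [hu]
      ring
    rw [h2] at hδ1 hδ2
    constructor <;> linarith

/-- **Engine interface, off the transition zones.** For `L ≥ 1`, `t ≥ 1`, a zero `s = 1/2 + it`
of `ζ`, and `0 < δ ≤ {t/(2πL)} ≤ 1 − δ`: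
`‖T_{2L}(s) + afeCoeff(s) 2^{1-s} ∑_{ν ≤ [t/(2πL)], ν odd} ν^{s-1}‖`
`≤ 27 (2L)^{-1/2} (1 + log(t/(2πL) + 2)) + 8 (2L)^{-1/2}/δ`. [folklore] -/
theorem norm_altSum_add_dual_le_off {t δ : ℝ} {L : ℕ} (hL : 1 ≤ L) (ht1 : 1 ≤ t) (hδ0 : 0 < δ)
    (hδf : δ ≤ Int.fract (t / (2 * π * L))) (hδg : δ ≤ 1 - Int.fract (t / (2 * π * L)))
    (s : ℂ) (hs : s = 1 / 2 + t * I) (hzero : riemannZeta s = 0) :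
    ‖∑ m ∈ Finset.Icc 1 (2 * L), (-1 : ℂ) ^ m * (m : ℂ) ^ (-s)
        + afeCoeff s * (2 : ℂ) ^ (1 - s)
          * ∑ ν ∈ (Finset.Icc 1 ⌊t / (2 * π * L)⌋₊).filter (fun ν => Odd ν), (ν : ℂ) ^ (s - 1)‖
      ≤ 27 * ((2 * L : ℕ) : ℝ) ^ (-(1 / 2 : ℝ)) * (1 + Real.log (t / (2 * π * L) + 2))
        + 8 * ((2 * L : ℕ) : ℝ) ^ (-(1 / 2 : ℝ)) / δ := by
  have hπ := Real.pi_pos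
  have hπ3 := Real.pi_gt_three
  have hL0 : 0 < L := by omega
  have hL0R : (0 : ℝ) < L := by exact_mod_cast hL0
  have h2L : 1 ≤ 2 * L := by omega
  have hfr1 : Int.fract (t / (2 * π * L)) < 1 := Int.fract_lt_one _
  have hδ1 : δ ≤ 1 := by linarith
  -- `Q(L)`
  have hdL : 1 ≤ ⌊t / (2 * π * L)⌋₊ → 0 < Int.fract (t / (2 * π * L)) := fun _ => by linarith
  have hQL := norm_zeta_sub_refined_dist ht1 hL hdL s hs
  -- `Q(2L)`: `t/(2π·2L) = u` with `2u = t/(2πL)`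
  set u : ℝ := t / (2 * π * ((2 * L : ℕ) : ℝ)) with hu
  have h2u : 2 * u = t / (2 * π * L) := by rw [hu]; push_cast; field_simp
  have hfb := fract_half_bounds (u := u) (δ := δ) (by rw [h2u]; exact hδf) (by rw [h2u]; exact hδg)
  have hd2 : 1 ≤ ⌊t / (2 * π * ((2 * L : ℕ) : ℝ))⌋₊ →
      0 < Int.fract (t / (2 * π * ((2 * L : ℕ) : ℝ))) := fun _ => by rw [← hu]; linarith [hfb.1]
  have hQ2 := norm_zeta_sub_refined_dist ht1 h2L hd2 s hs
  rw [← hu] at hQ2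
  -- combine
  have hmain := norm_altSum_add_dual_le_of_zero L s hs hzero
  refine hmain.trans ?_
  rw [← hu]
  set A1 : ℝ := (L : ℝ) ^ (-(1 / 2 : ℝ)) with hA1
  set A2 : ℝ := ((2 * L : ℕ) : ℝ) ^ (-(1 / 2 : ℝ)) with hA2
  set ℓ1 : ℝ := 1 + Real.log (t / (2 * π * L) + 2) with hℓ1
  set ℓ2 : ℝ := 1 + Real.log (u + 2) with hℓ2
  have hA2pos : 0 < A2 := Real.rpow_pos_of_pos (by positivity) _
  have hA12 : A1 = Real.sqrt 2 * A2 := by rw [hA1, hA2]; exact rpow_neg_half_eq_sqrt_two_mul hL0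
  have hs2 : Real.sqrt 2 * Real.sqrt 2 = 2 := Real.mul_self_sqrt (by norm_num)
  have hs2' : 0 < Real.sqrt 2 := Real.sqrt_pos.2 (by norm_num)
  have hy0 : 0 < t / (2 * π * L) := by positivity
  have hu0 : 0 < u := by rw [hu]; positivity
  have hℓ10 : 0 ≤ ℓ1 := by
    have : 0 ≤ Real.log (t / (2 * π * L) + 2) := Real.log_nonneg (by linarith); linarith
  have hℓ21 : ℓ2 ≤ ℓ1 := by
    have : u ≤ t / (2 * π * L) := by rw [← h2u]; linarith
    have := Real.log_le_log (by linarith) (by linarith : u + 2 ≤ t / (2 * π * L) + 2)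
    linarith
  -- the `1/fract` terms of `Q(L)`
  have hT1 : (if 1 ≤ ⌊t / (2 * π * L)⌋₊ then 2 / π * A1 / Int.fract (t / (2 * π * L)) else 0)
      ≤ 2 / π * A1 / δ := by
    split_ifs
    · exact div_le_div_of_nonneg_left (by positivity) hδ0 hδf
    · positivity
  have hT2 : 4 / π * A1 / (1 - Int.fract (t / (2 * π * L))) ≤ 4 / π * A1 / δ :=
    div_le_div_of_nonneg_left (by positivity) hδ0 hδg
  -- the `1/fract` terms of `Q(2L)`
  have hT3 : (if 1 ≤ ⌊u⌋₊ then 2 / π * A2 / Int.fract u else 0) ≤ 2 / π * A2 / (δ / 2) := by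
    split_ifs
    · exact div_le_div_of_nonneg_left (by positivity) (by positivity) hfb.1
    · positivity
  have hT4 : 4 / π * A2 / (1 - Int.fract u) ≤ 4 / π * A2 / (δ / 2) :=
    div_le_div_of_nonneg_left (by positivity) (by positivity) hfb.2
  -- numerical constants
  have hc1 : Real.sqrt 2 * (9 * A1 * ℓ1) = 18 * A2 * ℓ1 := by
    rw [hA12]
    calc Real.sqrt 2 * (9 * (Real.sqrt 2 * A2) * ℓ1)
        = 9 * (Real.sqrt 2 * Real.sqrt 2) * A2 * ℓ1 := by ring
      _ = 18 * A2 * ℓ1 := by rw [hs2]; ring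
  have hc2 : Real.sqrt 2 * (2 / π * A1 / δ + 4 / π * A1 / δ) = 12 / π * A2 / δ := by
    rw [hA12]
    calc Real.sqrt 2 * (2 / π * (Real.sqrt 2 * A2) / δ + 4 / π * (Real.sqrt 2 * A2) / δ)
        = (Real.sqrt 2 * Real.sqrt 2) * (6 / π * A2 / δ) := by ring
      _ = 12 / π * A2 / δ := by rw [hs2]; ring
  have hc3 : 2 / π * A2 / (δ / 2) + 4 / π * A2 / (δ / 2) = 12 / π * A2 / δ := by
    field_simp; ring
  have hπinv : 24 / π * A2 / δ ≤ 8 * A2 / δ := by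
    apply div_le_div_of_nonneg_right _ hδ0.le
    rw [div_mul_eq_mul_div, div_le_iff₀ hπ]
    have := mul_nonneg (mul_nonneg (by norm_num : (0 : ℝ) ≤ 8) hA2pos.le) (sub_nonneg.2 hπ3.le)
    linarith
  have h9 : 9 * A2 * ℓ2 ≤ 9 * A2 * ℓ1 := mul_le_mul_of_nonneg_left hℓ21 (by positivity)
  have hQL' : ‖riemannZeta s - ∑ n ∈ Finset.Icc 1 L, (n : ℂ) ^ (-s) + (L : ℂ) ^ (1 - s) / (1 - s)
        - afeCoeff s * ∑ n ∈ Finset.Icc 1 ⌊t / (2 * π * L)⌋₊, (n : ℂ) ^ (s - 1)‖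
      ≤ 9 * A1 * ℓ1 + (2 / π * A1 / δ + 4 / π * A1 / δ) := by linarith [hQL, hT1, hT2]
  have hQ2' : ‖riemannZeta s - ∑ n ∈ Finset.Icc 1 (2 * L), (n : ℂ) ^ (-s)
        + ((2 * L : ℕ) : ℂ) ^ (1 - s) / (1 - s)
        - afeCoeff s * ∑ n ∈ Finset.Icc 1 ⌊u⌋₊, (n : ℂ) ^ (s - 1)‖
      ≤ 9 * A2 * ℓ1 + 12 / π * A2 / δ := by linarith [hQ2, hT3, hT4, hc3, h9]
  have hstep : Real.sqrt 2 * (9 * A1 * ℓ1 + (2 / π * A1 / δ + 4 / π * A1 / δ))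
      = 18 * A2 * ℓ1 + 12 / π * A2 / δ := by rw [mul_add, hc1, hc2]
  calc Real.sqrt 2 * ‖riemannZeta s - ∑ n ∈ Finset.Icc 1 L, (n : ℂ) ^ (-s)
          + (L : ℂ) ^ (1 - s) / (1 - s)
          - afeCoeff s * ∑ n ∈ Finset.Icc 1 ⌊t / (2 * π * L)⌋₊, (n : ℂ) ^ (s - 1)‖
        + ‖riemannZeta s - ∑ n ∈ Finset.Icc 1 (2 * L), (n : ℂ) ^ (-s)
          + ((2 * L : ℕ) : ℂ) ^ (1 - s) / (1 - s)
          - afeCoeff s * ∑ n ∈ Finset.Icc 1 ⌊u⌋₊, (n : ℂ) ^ (s - 1)‖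
      ≤ Real.sqrt 2 * (9 * A1 * ℓ1 + (2 / π * A1 / δ + 4 / π * A1 / δ))
        + (9 * A2 * ℓ1 + 12 / π * A2 / δ) := by
        gcongr
    _ = 27 * A2 * ℓ1 + 24 / π * A2 / δ := by rw [hstep]; ring
    _ ≤ 27 * A2 * ℓ1 + 8 * A2 / δ := by linarith [hπinv]

/-- **Engine interface, in (and out of) the transition zones.** For `L ≥ 4`, `t ≥ 1`, a zero
`s = 1/2 + it` of `ζ`:
`‖T_{2L}(s) + afeCoeff(s) 2^{1-s} ∑_{ν ≤ [t/(2πL)], ν odd} ν^{s-1}‖`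
`≤ 27 (2L)^{-1/2} (1 + log(t/(2πL) + 2)) + 14√2/√(t/(2πL))`. [folklore] -/
theorem norm_altSum_add_dual_le_in {t : ℝ} {L : ℕ} (hL : 4 ≤ L) (ht1 : 1 ≤ t)
    (s : ℂ) (hs : s = 1 / 2 + t * I) (hzero : riemannZeta s = 0) :
    ‖∑ m ∈ Finset.Icc 1 (2 * L), (-1 : ℂ) ^ m * (m : ℂ) ^ (-s)
        + afeCoeff s * (2 : ℂ) ^ (1 - s)
          * ∑ ν ∈ (Finset.Icc 1 ⌊t / (2 * π * L)⌋₊).filter (fun ν => Odd ν), (ν : ℂ) ^ (s - 1)‖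
      ≤ 27 * ((2 * L : ℕ) : ℝ) ^ (-(1 / 2 : ℝ)) * (1 + Real.log (t / (2 * π * L) + 2))
        + 14 * Real.sqrt 2 / Real.sqrt (t / (2 * π * L)) := by
  have hπ := Real.pi_pos
  have hL0 : 0 < L := by omega
  have hL0R : (0 : ℝ) < L := by exact_mod_cast hL0
  have h2L : 4 ≤ 2 * L := by omega
  have hQL := norm_zeta_sub_refined_transition ht1 hL s hs
  set u : ℝ := t / (2 * π * ((2 * L : ℕ) : ℝ)) with hu
  have h2u : 2 * u = t / (2 * π * L) := by rw [hu]; push_cast; field_simp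
  have hQ2 := norm_zeta_sub_refined_transition ht1 h2L s hs
  rw [← hu] at hQ2
  have hmain := norm_altSum_add_dual_le_of_zero L s hs hzero
  refine hmain.trans ?_
  rw [← hu]
  set A1 : ℝ := (L : ℝ) ^ (-(1 / 2 : ℝ)) with hA1
  set A2 : ℝ := ((2 * L : ℕ) : ℝ) ^ (-(1 / 2 : ℝ)) with hA2
  set ℓ1 : ℝ := 1 + Real.log (t / (2 * π * L) + 2) with hℓ1
  set ℓ2 : ℝ := 1 + Real.log (u + 2) with hℓ2
  set y : ℝ := t / (2 * π * L) with hy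
  have hA2pos : 0 < A2 := Real.rpow_pos_of_pos (by positivity) _
  have hA12 : A1 = Real.sqrt 2 * A2 := by rw [hA1, hA2]; exact rpow_neg_half_eq_sqrt_two_mul hL0
  have hs2 : Real.sqrt 2 * Real.sqrt 2 = 2 := Real.mul_self_sqrt (by norm_num)
  have hs2' : 0 < Real.sqrt 2 := Real.sqrt_pos.2 (by norm_num)
  have hy0 : 0 < y := by rw [hy]; positivity
  have hu0 : 0 < u := by rw [hu]; positivity
  have hsy : 0 < Real.sqrt y := Real.sqrt_pos.2 hy0
  have hℓ21 : ℓ2 ≤ ℓ1 := by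
    have : u ≤ y := by rw [← h2u]; linarith
    have := Real.log_le_log (by linarith) (by linarith : u + 2 ≤ y + 2)
    linarith
  -- `7/√u = 7√2/√y`
  have hsu : Real.sqrt u = Real.sqrt y / Real.sqrt 2 := by
    rw [← Real.sqrt_div' _ (by norm_num : (0 : ℝ) ≤ 2)]
    congr 1
    linarith
  have e7 : 7 / Real.sqrt u = 7 * Real.sqrt 2 / Real.sqrt y := by
    rw [hsu]; field_simp
  have hc1 : Real.sqrt 2 * (9 * A1 * ℓ1) = 18 * A2 * ℓ1 := by
    rw [hA12]
    calc Real.sqrt 2 * (9 * (Real.sqrt 2 * A2) * ℓ1)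
        = 9 * (Real.sqrt 2 * Real.sqrt 2) * A2 * ℓ1 := by ring
      _ = 18 * A2 * ℓ1 := by rw [hs2]; ring
  have h9 : 9 * A2 * ℓ2 ≤ 9 * A2 * ℓ1 := mul_le_mul_of_nonneg_left hℓ21 (by positivity)
  calc Real.sqrt 2 * ‖riemannZeta s - ∑ n ∈ Finset.Icc 1 L, (n : ℂ) ^ (-s)
          + (L : ℂ) ^ (1 - s) / (1 - s)
          - afeCoeff s * ∑ n ∈ Finset.Icc 1 ⌊y⌋₊, (n : ℂ) ^ (s - 1)‖
        + ‖riemannZeta s - ∑ n ∈ Finset.Icc 1 (2 * L), (n : ℂ) ^ (-s)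
          + ((2 * L : ℕ) : ℂ) ^ (1 - s) / (1 - s)
          - afeCoeff s * ∑ n ∈ Finset.Icc 1 ⌊u⌋₊, (n : ℂ) ^ (s - 1)‖
      ≤ Real.sqrt 2 * (9 * A1 * ℓ1 + 7 / Real.sqrt y) + (9 * A2 * ℓ2 + 7 / Real.sqrt u) := by
        gcongr
    _ = 18 * A2 * ℓ1 + 9 * A2 * ℓ2 + 14 * Real.sqrt 2 / Real.sqrt y := by
        rw [mul_add, hc1, e7]; ring
    _ ≤ 27 * A2 * ℓ1 + 14 * Real.sqrt 2 / Real.sqrt y := by linarith [h9]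

end Summit.RiemannHypothesis.RiemannHypothesis.Theorems.EtaLeadingQuarter.SecondMomentAFE

end
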